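import Literature.AlgebraicTopology.KTheory.BottIndex3
import HarnessLib

/-!
# The index map of Bott periodicity, IV: base units and additivity of `ind`

* `indGL_baseUnit_mul_left : ind(c^A g) = ind(g)`, `indGL_conj : ind(c^A g d^A) = ind(g)`
  (`c d = d c = 1`), `indGL_mul_baseUnit_right : ind(g c^A) = ind(g)` for units `c, d` over `X`
  (the linearisation of `c·p` is `D₁(c)·Lᵈ(p)`, of `c p c⁻¹` is `D(c) Lᵈ(p) D(c)⁻¹`);
* block sums `glSum g₁ g₂` (re-indexed to `Fin (n + n')`), operator-norm bounds, admissible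
  approximants of block sums, and **`indGL_glSum : ind(g₁ ⊕ g₂) = ind(g₁) + ind(g₂)`**.

Everything is proved; no named facts.

## References

* D. Husemöller, *Fibre Bundles*, 3rd ed. (1994) [HusemollerFibreBundles1994]: Ch. 11 Prop. 5.3,
  Thm. 5.4.
-/

noncomputable section

open Set Metric unitInterval Complex

namespace Literature.AlgebraicTopology.KTheory

open Literature.RingTheory.KTheory Matrix Pencil Linearization

universe u

variable {X : Type u} [TopologicalSpace X] [CompactSpace X] [T2Space X]
variable {n : ℕ}

/-! ### Multiplying Laurent data by units over `X` -/

section BaseUnits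

attribute [local instance] Matrix.linftyOpNormedRing Matrix.linftyOpNormedAlgebra

variable {ι' : Type} [Fintype ι']

omit [CompactSpace X] [T2Space X] in
/-- `∑ z^{eᵢ} (c Aᵢ d) = c^A (∑ z^{eᵢ} Aᵢ) d^A`. [folklore] -/
theorem laurentMatrix_conj (c d : Matrix (Fin n) (Fin n) C(X, ℂ)) (A : ι' → Matrix (Fin n) (Fin n) C(X, ℂ)) (e : ι' → ℤ) :
    laurentMatrix (fun i ↦ c * A i * d) e = liftA c * laurentMatrix A e * liftA d := by
  simp only [laurentMatrix, Finset.mul_sum, Finset.sum_mul]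
  refine Finset.sum_congr rfl fun i _ ↦ ?_
  rw [Matrix.map_mul, Matrix.map_mul]
  change _ = liftA c * ((((zU ^ e i : (C(↥(pieceUp X ∩ pieceDn X), ℂ))ˣ) : C(↥(pieceUp X ∩ pieceDn X), ℂ))) • liftA (A i)) * liftA d
  have e1 := Matrix.mul_smul (liftA c) (((zU ^ e i : (C(↥(pieceUp X ∩ pieceDn X), ℂ))ˣ) : C(↥(pieceUp X ∩ pieceDn X), ℂ))) (liftA (A i))
  have e2 := Matrix.smul_mul (((zU ^ e i : (C(↥(pieceUp X ∩ pieceDn X), ℂ))ˣ) : C(↥(pieceUp X ∩ pieceDn X), ℂ)))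
    (liftA c * liftA (A i)) (liftA d)
  rw [e1, e2]

/-- **Admissible approximants of `c^A g d^A` from approximants of `g`.** [folklore] -/
theorem exists_isApprox_conj (g : Matrix (Fin n) (Fin n) C(↥(pieceUp X ∩ pieceDn X), ℂ)) (c d : Matrix (Fin n) (Fin n) C(X, ℂ)) :
    ∃ (ι' : Type) (_ : Fintype ι') (A : ι' → Matrix (Fin n) (Fin n) C(X, ℂ)) (e : ι' → ℤ),
      IsApprox g A e ∧ IsApprox (liftA c * g * liftA d) (fun i ↦ c * A i * d) e := by
  set K : ℝ := ‖liftA c‖ * ‖liftA d‖ + 1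
  have hK : 0 < K := by positivity
  obtain ⟨ι', _, A, e, h⟩ := exists_laurentMatrix_near g (lt_min (eps0_pos g) (div_pos (eps0_pos (liftA c * g * liftA d)) hK))
  refine ⟨ι', inferInstance, A, e, h.trans_le (min_le_left _ _), ?_⟩
  rw [IsApprox, laurentMatrix_conj, ← Matrix.sub_mul, ← Matrix.mul_sub]
  calc ‖liftA c * (g - laurentMatrix A e) * liftA d‖ ≤ ‖liftA c‖ * ‖g - laurentMatrix A e‖ * ‖liftA d‖ :=
        (norm_mul_le _ _).trans (mul_le_mul_of_nonneg_right (norm_mul_le _ _) (norm_nonneg _))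
    _ = ‖liftA c‖ * ‖liftA d‖ * ‖g - laurentMatrix A e‖ := by ring
    _ ≤ K * ‖g - laurentMatrix A e‖ := by gcongr; linarith
    _ < K * (eps0 (liftA c * g * liftA d) / K) := by gcongr; exact h.trans_le (min_le_right _ _)
    _ = eps0 (liftA c * g * liftA d) := mul_div_cancel₀ _ hK.ne'

omit [CompactSpace X] [T2Space X] in
/-- Auxiliary statement for the index map of Bott periodicity. [folklore] -/
theorem lcoeff_conj (c d : Matrix (Fin n) (Fin n) C(X, ℂ)) (A : ι' → Matrix (Fin n) (Fin n) C(X, ℂ)) (e : ι' → ℤ) (s dd : ℕ) (k : Fin (dd + 1)) :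
    lcoeff (fun i ↦ c * A i * d) e s dd k = c * lcoeff A e s dd k * d := by
  simp only [lcoeff, Finset.mul_sum, Finset.sum_mul]

/-! ### The block units `D₁(c) = diag(c, 1, …, 1)` and `D(c) = diag(c, …, c)` -/

variable {dd : ℕ}

/-- `diag(c, 1, …, 1)` at the entry level. [folklore] -/
def Done (dd : ℕ) (c : Matrix (Fin n) (Fin n) C(X, ℂ)) : Matrix (Fin (dd + 1) × Fin n) (Fin (dd + 1) × Fin n) C(X, ℂ) :=
  Matrix.comp _ _ _ _ _ (Matrix.diagonal fun r : Fin (dd + 1) ↦ if r = 0 then c else 1)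

/-- `diag(c, …, c)` at the entry level. [folklore] -/
def Dall (dd : ℕ) (c : Matrix (Fin n) (Fin n) C(X, ℂ)) : Matrix (Fin (dd + 1) × Fin n) (Fin (dd + 1) × Fin n) C(X, ℂ) :=
  Matrix.comp _ _ _ _ _ (Matrix.diagonal fun _ : Fin (dd + 1) ↦ c)

omit [CompactSpace X] [T2Space X] [Fintype ι'] in
/-- Auxiliary statement for the index map of Bott periodicity. [folklore] -/
theorem comp_mul' {α : Type} [Fintype α] [DecidableEq α] (M N : Matrix α α (Matrix (Fin n) (Fin n) C(X, ℂ))) :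
    Matrix.comp _ _ _ _ _ (M * N) = Matrix.comp _ _ _ _ _ M * Matrix.comp _ _ _ _ _ N :=
  map_mul (Matrix.compRingEquiv α (Fin n) C(X, ℂ)) M N

omit [CompactSpace X] [T2Space X] [Fintype ι'] in
/-- Auxiliary statement for the index map of Bott periodicity. [folklore] -/
theorem Done_mul_Done (c c' : Matrix (Fin n) (Fin n) C(X, ℂ)) : Done dd c * Done dd c' = Done dd (c * c') := by
  rw [Done, Done, Done, ← comp_mul', Matrix.diagonal_mul_diagonal]
  congr 2; funext r; split_ifs <;> simp

omit [CompactSpace X] [T2Space X] [Fintype ι'] in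
/-- Auxiliary statement for the index map of Bott periodicity. [folklore] -/
theorem Dall_mul_Dall (c c' : Matrix (Fin n) (Fin n) C(X, ℂ)) : Dall dd c * Dall dd c' = Dall dd (c * c') := by
  rw [Dall, Dall, Dall, ← comp_mul', Matrix.diagonal_mul_diagonal]

omit [CompactSpace X] [T2Space X] [Fintype ι'] in
/-- Auxiliary statement for the index map of Bott periodicity. [folklore] -/
theorem Done_one : Done dd (1 : Matrix (Fin n) (Fin n) C(X, ℂ)) = 1 := by
  rw [Done, ← Matrix.comp_one]; congr 1; ext r c : 1
  simp only [Matrix.diagonal_apply, Matrix.one_apply]; split_ifs <;> rfl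

omit [CompactSpace X] [T2Space X] [Fintype ι'] in
/-- Auxiliary statement for the index map of Bott periodicity. [folklore] -/
theorem Dall_one : Dall dd (1 : Matrix (Fin n) (Fin n) C(X, ℂ)) = 1 := by
  rw [Dall, ← Matrix.comp_one]; rfl

omit [CompactSpace X] [T2Space X] [Fintype ι'] in
/-- Auxiliary statement for the index map of Bott periodicity. [folklore] -/
theorem isUnit_Done {c : Matrix (Fin n) (Fin n) C(X, ℂ)} (hc : IsUnit c) : IsUnit (Done dd c) := by
  obtain ⟨u, rfl⟩ := hc
  exact ⟨⟨Done dd (↑u : Matrix (Fin n) (Fin n) C(X, ℂ)), Done dd (↑u⁻¹ : Matrix (Fin n) (Fin n) C(X, ℂ)),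
    by rw [Done_mul_Done, u.mul_inv, Done_one], by rw [Done_mul_Done, u.inv_mul, Done_one]⟩, rfl⟩

omit [CompactSpace X] [T2Space X] [Fintype ι'] in
/-- `linB (c a) = D₁(c) · linB a`. [folklore] -/
theorem linB_mul_left (c : Matrix (Fin n) (Fin n) C(X, ℂ)) (a : Fin (dd + 1) → Matrix (Fin n) (Fin n) C(X, ℂ)) :
    linB (fun k ↦ c * a k) = Done dd c * linB a := by
  rw [linB, linB, Done, ← comp_mul']
  congr 1
  ext r col : 1
  rw [Matrix.diagonal_mul]
  simp only [LmatA, Matrix.of_apply]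
  split_ifs <;> simp

omit [CompactSpace X] [T2Space X] [Fintype ι'] in
/-- `D₁(c) · linA = linA`. [folklore] -/
theorem Done_mul_linA (c : Matrix (Fin n) (Fin n) C(X, ℂ)) : Done dd c * linA X dd n = linA X dd n := by
  rw [linA, Done, ← comp_mul']
  congr 1
  ext r col : 1
  rw [Matrix.diagonal_mul]
  simp only [LmatB, Matrix.of_apply]
  split_ifs with h1 h2 <;> simp_all

omit [CompactSpace X] [T2Space X] [Fintype ι'] in
/-- `linB (c a d) = D(c) · linB a · D(d)` when `c d = 1`. [folklore] -/
theorem linB_conj {c d : Matrix (Fin n) (Fin n) C(X, ℂ)} (hcd : c * d = 1) (a : Fin (dd + 1) → Matrix (Fin n) (Fin n) C(X, ℂ)) :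
    linB (fun k ↦ c * a k * d) = Dall dd c * linB a * Dall dd d := by
  rw [linB, linB, Dall, Dall, ← comp_mul', ← comp_mul']
  congr 1
  ext r col : 1
  rw [Matrix.mul_diagonal, Matrix.diagonal_mul]
  simp only [LmatA, Matrix.of_apply]
  split_ifs
  · rfl
  · rw [Matrix.mul_one, hcd]
  · rw [Matrix.mul_zero, Matrix.zero_mul]

omit [CompactSpace X] [T2Space X] [Fintype ι'] in
/-- `D(c) · linA · D(d) = linA` when `c d = 1`. [folklore] -/
theorem linA_conj {c d : Matrix (Fin n) (Fin n) C(X, ℂ)} (hcd : c * d = 1) : Dall dd c * linA X dd n * Dall dd d = linA X dd n := by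
  rw [linA, Dall, Dall, ← comp_mul', ← comp_mul']
  congr 1
  ext r col : 1
  rw [Matrix.mul_diagonal, Matrix.diagonal_mul]
  simp only [LmatB, Matrix.of_apply]
  split_ifs
  · rw [Matrix.mul_neg, Matrix.mul_one, Matrix.neg_mul, hcd]
  · rw [Matrix.mul_zero, Matrix.zero_mul]

omit [CompactSpace X] [T2Space X] [Fintype ι'] in
/-- Auxiliary statement for the index map of Bott periodicity. [folklore] -/
theorem liftA_one' : liftA (1 : Matrix (Fin n) (Fin n) C(X, ℂ)) = 1 := Matrix.map_one _ (map_zero _) (map_one _)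

/-- **`ind(c^A g) = ind(g)`** for a unit `c` over `X`. [cite: HusemollerFibreBundles1994, Ch. 11 Prop. 5.3] -/
theorem indGL_baseUnit_mul_left {g : Matrix (Fin n) (Fin n) C(↥(pieceUp X ∩ pieceDn X), ℂ)} (hg : IsUnit g) {c : Matrix (Fin n) (Fin n) C(X, ℂ)}
    (hc : IsUnit c) : indGL (liftA c * g) = indGL g := by
  obtain ⟨ι', _, A, e, hA, hcA⟩ := exists_isApprox_conj g c 1
  rw [liftA_one', Matrix.mul_one] at hcA
  have hcg : IsUnit (liftA c * g) := (hc.map (RingHom.mapMatrix _)).mul hg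
  have hadm := adm_laurentShift e
  rw [indGL_eq hcg hcA hadm, indGL_eq hg hA hadm]
  have h1 := isUnit_linClutch_lcoeff A hadm (hA.isUnit hg)
  have h2 := isUnit_linClutch_lcoeff (fun i ↦ c * A i * 1) hadm (hcA.isUnit hcg)
  rw [Jval_eq _ h1, Jval_eq _ h2]
  congr 1
  have e1 : linB (lcoeff (fun i ↦ c * A i * 1) e (laurentShift e) (laurentDeg e)) = Done _ c * linB (lcoeff A e (laurentShift e) (laurentDeg e)) := by
    rw [← linB_mul_left]; congr 1; funext k; rw [lcoeff_conj, Matrix.mul_one]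
  have e2 : linA X (laurentDeg e) n = Done _ c * linA X (laurentDeg e) n := (Done_mul_linA c).symm
  have h3 := isUnit_linClutch_unit_mul (isUnit_Done (dd := laurentDeg e) hc) h1
  rw [plusClass_congr h2 h3 e2 e1, plusClass_unit_mul (isUnit_Done hc) h1 h3]

omit [CompactSpace X] [T2Space X] [Fintype ι'] in
/-- Auxiliary statement for the index map of Bott periodicity. [folklore] -/
theorem isUnit_Dall_pair {c d : Matrix (Fin n) (Fin n) C(X, ℂ)} (hcd : c * d = 1) (hdc : d * c = 1) :
    Dall dd c * Dall dd d = 1 ∧ Dall dd d * Dall dd c = 1 := by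
  rw [Dall_mul_Dall, Dall_mul_Dall, hcd, hdc, Dall_one]; exact ⟨rfl, rfl⟩

/-- **`ind(c^A g d^A) = ind(g)`** for units `c d = d c = 1` over `X`. [cite: HusemollerFibreBundles1994, Ch. 11 Prop. 5.3] -/
theorem indGL_conj {g : Matrix (Fin n) (Fin n) C(↥(pieceUp X ∩ pieceDn X), ℂ)} (hg : IsUnit g) {c d : Matrix (Fin n) (Fin n) C(X, ℂ)}
    (hcd : c * d = 1) (hdc : d * c = 1) : indGL (liftA c * g * liftA d) = indGL g := by
  obtain ⟨ι', _, A, e, hA, hcA⟩ := exists_isApprox_conj g c d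
  have hc : IsUnit c := ⟨⟨c, d, hcd, hdc⟩, rfl⟩
  have hd : IsUnit d := ⟨⟨d, c, hdc, hcd⟩, rfl⟩
  have hcg : IsUnit (liftA c * g * liftA d) := ((hc.map (RingHom.mapMatrix _)).mul hg).mul (hd.map (RingHom.mapMatrix _))
  have hadm := adm_laurentShift e
  rw [indGL_eq hcg hcA hadm, indGL_eq hg hA hadm]
  have h1 := isUnit_linClutch_lcoeff A hadm (hA.isUnit hg)
  have h2 := isUnit_linClutch_lcoeff (fun i ↦ c * A i * d) hadm (hcA.isUnit hcg)
  rw [Jval_eq _ h1, Jval_eq _ h2]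
  congr 1
  have e1 : linB (lcoeff (fun i ↦ c * A i * d) e (laurentShift e) (laurentDeg e)) =
      Dall _ c * linB (lcoeff A e (laurentShift e) (laurentDeg e)) * Dall _ d := by
    rw [← linB_conj hcd]; congr 1; funext k; rw [lcoeff_conj]
  have e2 : linA X (laurentDeg e) n = Dall _ c * linA X (laurentDeg e) n * Dall _ d := (linA_conj hcd).symm
  obtain ⟨hCD, hDC⟩ := isUnit_Dall_pair (dd := laurentDeg e) hcd hdc
  have h3 : IsUnit (linClutch (Dall _ c * linA X (laurentDeg e) n * Dall _ d) (Dall _ c * linB (lcoeff A e (laurentShift e) (laurentDeg e)) * Dall _ d)) := by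
    rw [← e1, ← e2]; exact h2
  rw [plusClass_congr h2 h3 e2 e1, plusClass_conj hCD hDC h1 h3]

omit [CompactSpace X] [T2Space X] [Fintype ι'] in
/-- Auxiliary statement for the index map of Bott periodicity. [folklore] -/
theorem liftA_mul' (c d : Matrix (Fin n) (Fin n) C(X, ℂ)) : liftA (c * d) = liftA c * liftA d := Matrix.map_mul

/-- **`ind(g c^A) = ind(g)`** for a unit `c` over `X`. [cite: HusemollerFibreBundles1994, Ch. 11 Prop. 5.3] -/
theorem indGL_mul_baseUnit_right {g : Matrix (Fin n) (Fin n) C(↥(pieceUp X ∩ pieceDn X), ℂ)} (hg : IsUnit g) {c : Matrix (Fin n) (Fin n) C(X, ℂ)}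
    (hc : IsUnit c) : indGL (g * liftA c) = indGL g := by
  obtain ⟨u, rfl⟩ := hc
  have e1 : g * liftA (↑u : Matrix (Fin n) (Fin n) C(X, ℂ)) = liftA (↑u : Matrix (Fin n) (Fin n) C(X, ℂ)) * (liftA (↑u⁻¹ : Matrix (Fin n) (Fin n) C(X, ℂ)) * g * liftA (↑u : Matrix (Fin n) (Fin n) C(X, ℂ))) := by
    rw [← Matrix.mul_assoc, ← Matrix.mul_assoc, ← liftA_mul', u.mul_inv, liftA_one', Matrix.one_mul]
  have hconj : IsUnit (liftA (↑u⁻¹ : Matrix (Fin n) (Fin n) C(X, ℂ)) * g * liftA (↑u : Matrix (Fin n) (Fin n) C(X, ℂ))) :=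
    (((Units.isUnit u⁻¹).map (RingHom.mapMatrix _)).mul hg).mul ((Units.isUnit u).map (RingHom.mapMatrix _))
  rw [e1, indGL_baseUnit_mul_left hconj (Units.isUnit u), indGL_conj hg u.inv_mul u.mul_inv]

end BaseUnits

/-! ### Additivity of `ind` over block sums -/

section Additivity

attribute [local instance] Matrix.linftyOpSeminormedAddCommGroup Matrix.linftyOpNormedAddCommGroup Matrix.linftyOpNormedRing
  Matrix.linftyOpNormedAlgebra

variable {n' : ℕ}

omit [CompactSpace X] [T2Space X] in
/-- Re-indexing does not increase the operator norm. [folklore] -/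
theorem linfty_opNNNorm_reindex_le {R : Type*} [SeminormedAddCommGroup R] {m m' : Type} [Fintype m] [Fintype m'] (e : m ≃ m') (M : Matrix m m R) :
    ‖Matrix.reindex e e M‖₊ ≤ ‖M‖₊ := by
  rw [Matrix.linfty_opNNNorm_def, Matrix.linfty_opNNNorm_def, Finset.sup_le_iff]
  intro i _
  have : ∑ j, ‖Matrix.reindex e e M i j‖₊ = ∑ j, ‖M (e.symm i) j‖₊ :=
    Equiv.sum_comp e.symm (fun j' ↦ ‖M (e.symm i) j'‖₊)
  rw [this]
  exact Finset.le_sup (f := fun i ↦ ∑ j, ‖M i j‖₊) (Finset.mem_univ (e.symm i))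

omit [CompactSpace X] [T2Space X] in
/-- The operator norm of a block-diagonal matrix. [folklore] -/
theorem linfty_opNNNorm_fromBlocks_le {R : Type*} [SeminormedAddCommGroup R] {m m' : Type} [Fintype m] [Fintype m'] (M : Matrix m m R) (N : Matrix m' m' R) :
    ‖Matrix.fromBlocks M 0 0 N‖₊ ≤ max ‖M‖₊ ‖N‖₊ := by
  rw [Matrix.linfty_opNNNorm_def, Finset.sup_le_iff]
  rintro (i | i) -
  · rw [Fintype.sum_sum_type]
    simp only [Matrix.fromBlocks_apply₁₁, Matrix.fromBlocks_apply₁₂, Matrix.zero_apply, nnnorm_zero, Finset.sum_const_zero, add_zero]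
    exact (Finset.le_sup (f := fun i ↦ ∑ j, ‖M i j‖₊) (Finset.mem_univ i)).trans ((Matrix.linfty_opNNNorm_def M).ge.trans (le_max_left _ _))
  · rw [Fintype.sum_sum_type]
    simp only [Matrix.fromBlocks_apply₂₁, Matrix.fromBlocks_apply₂₂, Matrix.zero_apply, nnnorm_zero, Finset.sum_const_zero, zero_add]
    exact (Finset.le_sup (f := fun i ↦ ∑ j, ‖N i j‖₊) (Finset.mem_univ i)).trans ((Matrix.linfty_opNNNorm_def N).ge.trans (le_max_right _ _))

/-- **Block sum of matrices over the overlap, re-indexed to `Fin (n + n')`.** [folklore] -/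
def glSum {R : Type*} (g₁ : Matrix (Fin n) (Fin n) R) (g₂ : Matrix (Fin n') (Fin n') R) [Zero R] : Matrix (Fin (n + n')) (Fin (n + n')) R :=
  Matrix.reindex finSumFinEquiv finSumFinEquiv (Matrix.fromBlocks g₁ 0 0 g₂)

omit [CompactSpace X] [T2Space X] in
/-- Auxiliary statement for the index map of Bott periodicity. [folklore] -/
@[simp] theorem glSum_apply {R : Type*} [Zero R] (g₁ : Matrix (Fin n) (Fin n) R) (g₂ : Matrix (Fin n') (Fin n') R) (i j : Fin n ⊕ Fin n') :
    glSum g₁ g₂ (finSumFinEquiv i) (finSumFinEquiv j) = Matrix.fromBlocks g₁ 0 0 g₂ i j := by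
  simp [glSum]

omit [CompactSpace X] [T2Space X] in
/-- Auxiliary statement for the index map of Bott periodicity. [folklore] -/
theorem glSum_sub {R : Type*} [AddGroup R] (g₁ h₁ : Matrix (Fin n) (Fin n) R) (g₂ h₂ : Matrix (Fin n') (Fin n') R) :
    glSum g₁ g₂ - glSum h₁ h₂ = glSum (g₁ - h₁) (g₂ - h₂) := by
  ext i j
  obtain ⟨i, rfl⟩ := finSumFinEquiv.surjective i
  obtain ⟨j, rfl⟩ := finSumFinEquiv.surjective j
  rw [Matrix.sub_apply, glSum_apply, glSum_apply, glSum_apply]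
  rcases i with i | i <;> rcases j with j | j <;> simp

omit [CompactSpace X] [T2Space X] in
/-- Auxiliary statement for the index map of Bott periodicity. [folklore] -/
theorem glSum_add {R : Type*} [AddMonoid R] (g₁ h₁ : Matrix (Fin n) (Fin n) R) (g₂ h₂ : Matrix (Fin n') (Fin n') R) :
    glSum g₁ g₂ + glSum h₁ h₂ = glSum (g₁ + h₁) (g₂ + h₂) := by
  ext i j
  obtain ⟨i, rfl⟩ := finSumFinEquiv.surjective i
  obtain ⟨j, rfl⟩ := finSumFinEquiv.surjective j
  rw [Matrix.add_apply, glSum_apply, glSum_apply, glSum_apply]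
  rcases i with i | i <;> rcases j with j | j <;> simp

omit [CompactSpace X] [T2Space X] in
/-- Auxiliary statement for the index map of Bott periodicity. [folklore] -/
theorem glSum_zero {R : Type*} [Zero R] : glSum (0 : Matrix (Fin n) (Fin n) R) (0 : Matrix (Fin n') (Fin n') R) = 0 := by
  rw [glSum, Matrix.fromBlocks_zero]; rfl

omit [CompactSpace X] [T2Space X] in
/-- Auxiliary statement for the index map of Bott periodicity. [folklore] -/
theorem glSum_smul {R : Type*} [MulZeroClass R] (r : R) (g₁ : Matrix (Fin n) (Fin n) R) (g₂ : Matrix (Fin n') (Fin n') R) :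
    r • glSum g₁ g₂ = glSum (r • g₁) (r • g₂) := by
  ext i j
  obtain ⟨i, rfl⟩ := finSumFinEquiv.surjective i
  obtain ⟨j, rfl⟩ := finSumFinEquiv.surjective j
  rw [Matrix.smul_apply, glSum_apply, glSum_apply]
  rcases i with i | i <;> rcases j with j | j <;> simp

omit [CompactSpace X] [T2Space X] in
/-- Auxiliary statement for the index map of Bott periodicity. [folklore] -/
theorem glSum_mul {R : Type*} [NonUnitalNonAssocSemiring R] (g₁ h₁ : Matrix (Fin n) (Fin n) R) (g₂ h₂ : Matrix (Fin n') (Fin n') R) :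
    glSum g₁ g₂ * glSum h₁ h₂ = glSum (g₁ * h₁) (g₂ * h₂) := by
  rw [glSum, glSum, glSum, Matrix.reindex_apply, Matrix.reindex_apply, Matrix.reindex_apply, Matrix.submatrix_mul_equiv, Matrix.fromBlocks_multiply]
  simp

omit [CompactSpace X] [T2Space X] in
/-- Auxiliary statement for the index map of Bott periodicity. [folklore] -/
theorem glSum_one {R : Type*} [MulZeroOneClass R] : glSum (1 : Matrix (Fin n) (Fin n) R) (1 : Matrix (Fin n') (Fin n') R) = 1 := by
  rw [glSum, Matrix.fromBlocks_one, Matrix.reindex_apply, Matrix.submatrix_one_equiv]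

omit [CompactSpace X] [T2Space X] in
/-- Auxiliary statement for the index map of Bott periodicity. [folklore] -/
theorem isUnit_glSum {R : Type*} [Ring R] {g₁ : Matrix (Fin n) (Fin n) R} {g₂ : Matrix (Fin n') (Fin n') R} (h₁ : IsUnit g₁) (h₂ : IsUnit g₂) :
    IsUnit (glSum g₁ g₂) := by
  obtain ⟨u₁, rfl⟩ := h₁
  obtain ⟨u₂, rfl⟩ := h₂
  exact ⟨⟨glSum (↑u₁ : Matrix (Fin n) (Fin n) R) (↑u₂ : Matrix (Fin n') (Fin n') R), glSum (↑u₁⁻¹ : Matrix (Fin n) (Fin n) R) (↑u₂⁻¹ : Matrix (Fin n') (Fin n') R),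
    by rw [glSum_mul, u₁.mul_inv, u₂.mul_inv, glSum_one], by rw [glSum_mul, u₁.inv_mul, u₂.inv_mul, glSum_one]⟩, rfl⟩

omit [CompactSpace X] [T2Space X] in
/-- Auxiliary statement for the index map of Bott periodicity. [folklore] -/
theorem glSum_map {R S : Type*} [Zero R] [Zero S] (f : R → S) (hf : f 0 = 0) (g₁ : Matrix (Fin n) (Fin n) R) (g₂ : Matrix (Fin n') (Fin n') R) :
    (glSum g₁ g₂).map f = glSum (g₁.map f) (g₂.map f) := by
  ext i j
  obtain ⟨i, rfl⟩ := finSumFinEquiv.surjective i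
  obtain ⟨j, rfl⟩ := finSumFinEquiv.surjective j
  rw [Matrix.map_apply, glSum_apply, glSum_apply]
  rcases i with i | i <;> rcases j with j | j <;> simp [hf]

omit [T2Space X] in
/-- Auxiliary statement for the index map of Bott periodicity. [folklore] -/
theorem norm_glSum_le (g₁ : Matrix (Fin n) (Fin n) C(↥(pieceUp X ∩ pieceDn X), ℂ)) (g₂ : Matrix (Fin n') (Fin n') C(↥(pieceUp X ∩ pieceDn X), ℂ)) :
    ‖glSum g₁ g₂‖ ≤ max ‖g₁‖ ‖g₂‖ := by
  have h := (linfty_opNNNorm_reindex_le finSumFinEquiv (Matrix.fromBlocks g₁ 0 0 g₂)).trans (linfty_opNNNorm_fromBlocks_le g₁ g₂)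
  exact_mod_cast h

variable {ι₁ ι₂ : Type} [Fintype ι₁] [Fintype ι₂]

/-- The block-sum Laurent data. [folklore] -/
def sumData (A₁ : ι₁ → Matrix (Fin n) (Fin n) C(X, ℂ)) (A₂ : ι₂ → Matrix (Fin n') (Fin n') C(X, ℂ)) : ι₁ ⊕ ι₂ → Matrix (Fin (n + n')) (Fin (n + n')) C(X, ℂ) :=
  Sum.elim (fun i ↦ glSum (A₁ i) 0) (fun j ↦ glSum 0 (A₂ j))


omit [CompactSpace X] [T2Space X] in
/-- `M ↦ M ⊕ 0` as an additive map. [folklore] -/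
def glSumInl {R : Type*} [AddMonoid R] (n n' : ℕ) : Matrix (Fin n) (Fin n) R →+ Matrix (Fin (n + n')) (Fin (n + n')) R where
  toFun M := glSum M 0
  map_zero' := glSum_zero
  map_add' M N := by rw [glSum_add, add_zero]

omit [CompactSpace X] [T2Space X] in
/-- `N ↦ 0 ⊕ N` as an additive map. [folklore] -/
def glSumInr {R : Type*} [AddMonoid R] (n n' : ℕ) : Matrix (Fin n') (Fin n') R →+ Matrix (Fin (n + n')) (Fin (n + n')) R where
  toFun M := glSum 0 M
  map_zero' := glSum_zero
  map_add' M N := by rw [glSum_add, add_zero]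

omit [CompactSpace X] [T2Space X] in
/-- The Laurent polynomial of the block-sum data is the block sum. [folklore] -/
theorem laurentMatrix_sumData (A₁ : ι₁ → Matrix (Fin n) (Fin n) C(X, ℂ)) (A₂ : ι₂ → Matrix (Fin n') (Fin n') C(X, ℂ)) (e₁ : ι₁ → ℤ) (e₂ : ι₂ → ℤ) :
    laurentMatrix (sumData A₁ A₂) (Sum.elim e₁ e₂) = glSum (laurentMatrix A₁ e₁) (laurentMatrix A₂ e₂) := by
  rw [laurentMatrix, Fintype.sum_sum_type]
  have hz1 : ∀ r : C(↥(pieceUp X ∩ pieceDn X), ℂ), r • (0 : Matrix (Fin n) (Fin n) C(↥(pieceUp X ∩ pieceDn X), ℂ)) = 0 := fun r ↦ by ext; simp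
  have hz2 : ∀ r : C(↥(pieceUp X ∩ pieceDn X), ℂ), r • (0 : Matrix (Fin n') (Fin n') C(↥(pieceUp X ∩ pieceDn X), ℂ)) = 0 := fun r ↦ by ext; simp
  have h1 : ∀ i, (((zU ^ (Sum.elim e₁ e₂ (Sum.inl i)) : (C(↥(pieceUp X ∩ pieceDn X), ℂ))ˣ) : C(↥(pieceUp X ∩ pieceDn X), ℂ)) • (sumData A₁ A₂ (Sum.inl i)).map (comapRingHom πA)) =
      glSumInl n n' ((((zU ^ (e₁ i)) : (C(↥(pieceUp X ∩ pieceDn X), ℂ))ˣ) : C(↥(pieceUp X ∩ pieceDn X), ℂ)) • (A₁ i).map (comapRingHom πA)) := by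
    intro i
    simp only [Sum.elim_inl, sumData]
    rw [glSum_map _ (map_zero _), Matrix.map_zero _ (map_zero _), glSum_smul, hz2]; rfl
  have h2 : ∀ j, (((zU ^ (Sum.elim e₁ e₂ (Sum.inr j)) : (C(↥(pieceUp X ∩ pieceDn X), ℂ))ˣ) : C(↥(pieceUp X ∩ pieceDn X), ℂ)) • (sumData A₁ A₂ (Sum.inr j)).map (comapRingHom πA)) =
      glSumInr n n' ((((zU ^ (e₂ j)) : (C(↥(pieceUp X ∩ pieceDn X), ℂ))ˣ) : C(↥(pieceUp X ∩ pieceDn X), ℂ)) • (A₂ j).map (comapRingHom πA)) := by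
    intro j
    simp only [Sum.elim_inr, sumData]
    rw [glSum_map _ (map_zero _), Matrix.map_zero _ (map_zero _), glSum_smul, hz1]; rfl
  simp only [h1, h2, ← map_sum]
  change glSum (laurentMatrix A₁ e₁) 0 + glSum 0 (laurentMatrix A₂ e₂) = _
  rw [glSum_add, add_zero, zero_add]

/-- **Admissible approximants of a block sum from approximants of the blocks.** [folklore] -/
theorem exists_isApprox_sum (g₁ : Matrix (Fin n) (Fin n) C(↥(pieceUp X ∩ pieceDn X), ℂ)) (g₂ : Matrix (Fin n') (Fin n') C(↥(pieceUp X ∩ pieceDn X), ℂ)) :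
    ∃ (ι₁ : Type) (_ : Fintype ι₁) (A₁ : ι₁ → Matrix (Fin n) (Fin n) C(X, ℂ)) (e₁ : ι₁ → ℤ) (ι₂ : Type) (_ : Fintype ι₂)
      (A₂ : ι₂ → Matrix (Fin n') (Fin n') C(X, ℂ)) (e₂ : ι₂ → ℤ),
      IsApprox g₁ A₁ e₁ ∧ IsApprox g₂ A₂ e₂ ∧ IsApprox (glSum g₁ g₂) (sumData A₁ A₂) (Sum.elim e₁ e₂) := by
  obtain ⟨ι₁, _, A₁, e₁, h₁⟩ := exists_laurentMatrix_near g₁ (lt_min (eps0_pos g₁) (eps0_pos (glSum g₁ g₂)))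
  obtain ⟨ι₂, _, A₂, e₂, h₂⟩ := exists_laurentMatrix_near g₂ (lt_min (eps0_pos g₂) (eps0_pos (glSum g₁ g₂)))
  refine ⟨ι₁, inferInstance, A₁, e₁, ι₂, inferInstance, A₂, e₂, h₁.trans_le (min_le_left _ _), h₂.trans_le (min_le_left _ _), ?_⟩
  rw [IsApprox, laurentMatrix_sumData, glSum_sub]
  exact (norm_glSum_le _ _).trans_lt (max_lt (h₁.trans_le (min_le_right _ _)) (h₂.trans_le (min_le_right _ _)))

omit [CompactSpace X] [T2Space X] in
/-- Auxiliary statement for the index map of Bott periodicity. [folklore] -/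
theorem lcoeff_sumData (A₁ : ι₁ → Matrix (Fin n) (Fin n) C(X, ℂ)) (A₂ : ι₂ → Matrix (Fin n') (Fin n') C(X, ℂ)) (e₁ : ι₁ → ℤ) (e₂ : ι₂ → ℤ) (s d : ℕ)
    (k : Fin (d + 1)) : lcoeff (sumData A₁ A₂) (Sum.elim e₁ e₂) s d k = glSum (lcoeff A₁ e₁ s d k) (lcoeff A₂ e₂ s d k) := by
  rw [lcoeff, lcoeff, lcoeff, Finset.sum_filter, Finset.sum_filter, Finset.sum_filter, Fintype.sum_sum_type]
  have h1 : ∀ i, (if Sum.elim e₁ e₂ (Sum.inl i) + s = (k : ℕ) then sumData A₁ A₂ (Sum.inl i) else 0) =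
      glSumInl n n' (if e₁ i + s = (k : ℕ) then A₁ i else 0) := by
    intro i; simp only [Sum.elim_inl, sumData]; split_ifs
    · rfl
    · exact glSum_zero.symm
  have h2 : ∀ j, (if Sum.elim e₁ e₂ (Sum.inr j) + s = (k : ℕ) then sumData A₁ A₂ (Sum.inr j) else 0) =
      glSumInr n n' (if e₂ j + s = (k : ℕ) then A₂ j else 0) := by
    intro j; simp only [Sum.elim_inr, sumData]; split_ifs
    · rfl
    · exact glSum_zero.symm
  simp only [h1, h2, ← map_sum]
  change glSum _ 0 + glSum 0 _ = _
  rw [glSum_add, add_zero, zero_add]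

variable {dd : ℕ}

/-- `(Fin (d+1) × Fin n) ⊕ (Fin (d+1) × Fin n') ≃ Fin (d+1) × Fin (n + n')`. [folklore] -/
def τidx (dd n n' : ℕ) : (Fin (dd + 1) × Fin n) ⊕ (Fin (dd + 1) × Fin n') ≃ Fin (dd + 1) × Fin (n + n') :=
  (Equiv.prodSumDistrib (Fin (dd + 1)) (Fin n) (Fin n')).symm.trans (Equiv.prodCongr (Equiv.refl _) finSumFinEquiv)

omit [CompactSpace X] [T2Space X] in
/-- Auxiliary statement for the index map of Bott periodicity. [folklore] -/
@[simp] theorem τidx_symm_inl (r : Fin (dd + 1)) (i : Fin n) : (τidx dd n n').symm (r, finSumFinEquiv (Sum.inl i)) = Sum.inl (r, i) := by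
  simp [τidx]

omit [CompactSpace X] [T2Space X] in
/-- Auxiliary statement for the index map of Bott periodicity. [folklore] -/
@[simp] theorem τidx_symm_inr (r : Fin (dd + 1)) (j : Fin n') : (τidx dd n n').symm (r, finSumFinEquiv (Sum.inr j)) = Sum.inr (r, j) := by
  simp [τidx]

omit [CompactSpace X] [T2Space X] in
/-- `linB` of block-sum coefficients is the block sum of the `linB`s, re-indexed. [folklore] -/
theorem linB_glSum (a : Fin (dd + 1) → Matrix (Fin n) (Fin n) C(X, ℂ)) (a' : Fin (dd + 1) → Matrix (Fin n') (Fin n') C(X, ℂ)) :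
    linB (fun k ↦ glSum (a k) (a' k)) = Matrix.reindex (τidx dd n n') (τidx dd n n') (Matrix.fromBlocks (linB a) 0 0 (linB a')) := by
  apply Matrix.ext
  rintro ⟨r, p⟩ ⟨c, q⟩
  obtain ⟨p, rfl⟩ := finSumFinEquiv.surjective p
  obtain ⟨q, rfl⟩ := finSumFinEquiv.surjective q
  rw [Matrix.reindex_apply, Matrix.submatrix_apply]
  rcases p with i | i <;> rcases q with j | j
  · rw [τidx_symm_inl, τidx_symm_inl, Matrix.fromBlocks_apply₁₁]
    change LmatA (fun k ↦ glSum (a k) (a' k)) r c (finSumFinEquiv (Sum.inl i)) (finSumFinEquiv (Sum.inl j)) = LmatA a r c i j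
    simp only [LmatA, Matrix.of_apply]
    split_ifs
    · exact glSum_apply _ _ _ _
    · simp [Matrix.one_apply]
    · rfl
  · rw [τidx_symm_inl, τidx_symm_inr, Matrix.fromBlocks_apply₁₂, Matrix.zero_apply]
    change LmatA (fun k ↦ glSum (a k) (a' k)) r c (finSumFinEquiv (Sum.inl i)) (finSumFinEquiv (Sum.inr j)) = 0
    simp only [LmatA, Matrix.of_apply]
    split_ifs
    · exact glSum_apply _ _ _ _
    · rw [Matrix.one_apply_ne]
      intro h; have := congrArg Fin.val h; simp at this; omega
    · rfl
  · rw [τidx_symm_inr, τidx_symm_inl, Matrix.fromBlocks_apply₂₁, Matrix.zero_apply]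
    change LmatA (fun k ↦ glSum (a k) (a' k)) r c (finSumFinEquiv (Sum.inr i)) (finSumFinEquiv (Sum.inl j)) = 0
    simp only [LmatA, Matrix.of_apply]
    split_ifs
    · exact glSum_apply _ _ _ _
    · rw [Matrix.one_apply_ne]
      intro h; have := congrArg Fin.val h; simp at this; omega
    · rfl
  · rw [τidx_symm_inr, τidx_symm_inr, Matrix.fromBlocks_apply₂₂]
    change LmatA (fun k ↦ glSum (a k) (a' k)) r c (finSumFinEquiv (Sum.inr i)) (finSumFinEquiv (Sum.inr j)) = LmatA a' r c i j
    simp only [LmatA, Matrix.of_apply]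
    split_ifs
    · exact glSum_apply _ _ _ _
    · simp [Matrix.one_apply]
    · rfl

omit [CompactSpace X] [T2Space X] in
/-- `linA` for size `n + n'` is the block sum of the `linA`s, re-indexed. [folklore] -/
theorem linA_glSum : linA X dd (n + n') = Matrix.reindex (τidx dd n n') (τidx dd n n') (Matrix.fromBlocks (linA X dd n) 0 0 (linA X dd n')) := by
  apply Matrix.ext
  rintro ⟨r, p⟩ ⟨c, q⟩
  obtain ⟨p, rfl⟩ := finSumFinEquiv.surjective p
  obtain ⟨q, rfl⟩ := finSumFinEquiv.surjective q
  rw [Matrix.reindex_apply, Matrix.submatrix_apply]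
  have key : ∀ (p q : Fin n ⊕ Fin n'), (LmatB dd (Fin (n + n')) C(X, ℂ) r c) (finSumFinEquiv p) (finSumFinEquiv q) =
      Matrix.fromBlocks (linA X dd n) 0 0 (linA X dd n') ((τidx dd n n').symm (r, finSumFinEquiv p)) ((τidx dd n n').symm (c, finSumFinEquiv q)) := by
    intro p q
    have h1 : (1 : Matrix (Fin (n + n')) (Fin (n + n')) C(X, ℂ)) (finSumFinEquiv p) (finSumFinEquiv q) =
        Matrix.fromBlocks (1 : Matrix (Fin n) (Fin n) C(X, ℂ)) 0 0 (1 : Matrix (Fin n') (Fin n') C(X, ℂ)) p q := by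
      rw [← glSum_one, glSum_apply]
    rcases p with i | i <;> rcases q with j | j
    · rw [τidx_symm_inl, τidx_symm_inl, Matrix.fromBlocks_apply₁₁]
      change _ = LmatB dd (Fin n) C(X, ℂ) r c i j
      simp only [LmatB, Matrix.of_apply]
      split_ifs
      · rw [Matrix.neg_apply, Matrix.neg_apply, h1, Matrix.fromBlocks_apply₁₁]
      · rfl
    · rw [τidx_symm_inl, τidx_symm_inr, Matrix.fromBlocks_apply₁₂, Matrix.zero_apply]
      simp only [LmatB, Matrix.of_apply]
      split_ifs
      · rw [Matrix.neg_apply, h1, Matrix.fromBlocks_apply₁₂, Matrix.zero_apply, neg_zero]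
      · rfl
    · rw [τidx_symm_inr, τidx_symm_inl, Matrix.fromBlocks_apply₂₁, Matrix.zero_apply]
      simp only [LmatB, Matrix.of_apply]
      split_ifs
      · rw [Matrix.neg_apply, h1, Matrix.fromBlocks_apply₂₁, Matrix.zero_apply, neg_zero]
      · rfl
    · rw [τidx_symm_inr, τidx_symm_inr, Matrix.fromBlocks_apply₂₂]
      change _ = LmatB dd (Fin n') C(X, ℂ) r c i j
      simp only [LmatB, Matrix.of_apply]
      split_ifs
      · rw [Matrix.neg_apply, Matrix.neg_apply, h1, Matrix.fromBlocks_apply₂₂]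
      · rfl
  exact key p q

omit [CompactSpace X] [T2Space X] [Fintype ι₁] [Fintype ι₂] in
/-- Auxiliary statement for the index map of Bott periodicity. [folklore] -/
theorem Adm.sum_elim {e₁ : ι₁ → ℤ} {e₂ : ι₂ → ℤ} {s d : ℕ} (h : Adm (Sum.elim e₁ e₂) s d) : Adm e₁ s d ∧ Adm e₂ s d :=
  ⟨fun i ↦ h (Sum.inl i), fun j ↦ h (Sum.inr j)⟩

/-- **Additivity of the index**: `ind(g₁ ⊕ g₂) = ind(g₁) + ind(g₂)`. [cite: HusemollerFibreBundles1994, Ch. 11 Prop. 5.3] -/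
theorem indGL_glSum {g₁ : Matrix (Fin n) (Fin n) C(↥(pieceUp X ∩ pieceDn X), ℂ)} {g₂ : Matrix (Fin n') (Fin n') C(↥(pieceUp X ∩ pieceDn X), ℂ)}
    (hg₁ : IsUnit g₁) (hg₂ : IsUnit g₂) : indGL (glSum g₁ g₂) = indGL g₁ + indGL g₂ := by
  obtain ⟨ι₁, _, A₁, e₁, ι₂, _, A₂, e₂, h₁, h₂, h⟩ := exists_isApprox_sum g₁ g₂
  have hG : IsUnit (glSum g₁ g₂) := isUnit_glSum hg₁ hg₂
  have hadm := adm_laurentShift (Sum.elim e₁ e₂)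
  obtain ⟨ha₁, ha₂⟩ := hadm.sum_elim
  set s := laurentShift (Sum.elim e₁ e₂)
  set d := laurentDeg (Sum.elim e₁ e₂)
  rw [indGL_eq hG h hadm, indGL_eq hg₁ h₁ ha₁, indGL_eq hg₂ h₂ ha₂]
  have hu := isUnit_linClutch_lcoeff _ hadm (h.isUnit hG)
  have hu₁ := isUnit_linClutch_lcoeff _ ha₁ (h₁.isUnit hg₁)
  have hu₂ := isUnit_linClutch_lcoeff _ ha₂ (h₂.isUnit hg₂)
  rw [Jval_eq _ hu, Jval_eq _ hu₁, Jval_eq _ hu₂]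
  have eB : linB (lcoeff (sumData A₁ A₂) (Sum.elim e₁ e₂) s d) =
      Matrix.reindex (τidx d n n') (τidx d n n') (Matrix.fromBlocks (linB (lcoeff A₁ e₁ s d)) 0 0 (linB (lcoeff A₂ e₂ s d))) := by
    rw [← linB_glSum]; congr 1; funext k; exact lcoeff_sumData A₁ A₂ e₁ e₂ s d k
  have hblk := isUnit_linClutch_fromBlocks hu₁ hu₂
  have hre := isUnit_linClutch_reindex (τidx d n n') hblk
  rw [plusClass_congr hu hre linA_glSum eB, plusClass_reindex _ _ _ hblk, plusClass_fromBlocks _ _ _ _ hu₁ hu₂]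
  push_cast
  ring

end Additivity

end Literature.AlgebraicTopology.KTheory

end
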